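/-
Copyright (c) 2026 the pub-hodgecm-mathlib formalisation cell (harness21).  Prover seat hodgecm-mathlib-K2Liu-p02 (g2),
Track B «K2-LIT» ∕ hLiu418 #184♮, tier-0 line rev. j stub s6′: THE WEIGHTED SEE-SAW EXCHANGE OVER THE COMPACT `[U(⟨a′⟩)]`
(LEAD F0P6-plan rulings «M-154s» (S2) ∕ «M-154u» 2026-09-03∕04: the centre-weight repair puts a continuous weight `f′` in the `q`-integral and
existentialises the second slot `W₂`).  2026-09-04.
-/
import Summits.HodgeConjecture.HodgeConjecture.Theorems.K2LiuSeesawFubini              -- ★ p855037 (s6, g0): same imports ∕ same adjunction engine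
import HarnessLib

/-!
# K2_Liu road (hLiu418 = stmt-HodgeConjecture-24832), tier-0 line `Cruxes/HLiu418/Lines/K2_Liu_CurveThetaNonOrthogonal.lean` rev. j,
# stub s6′ `SeesawFubini` (WEIGHTED): a non-zero weighted see-saw doubling pairing forces a non-zero opposite theta lift

Cell `pub/hodgecm-mathlib` (D-0151), Track B.  After the steward's finding «CENTRE WEIGHT» on socket #42 (REPORT-FIRST K2Liu-p02 (g2), UPHELD by
K2Liu-ref1, LEAD «M-154s» (S1)(S2)) the whole s5 seam carries a continuous weight `f′ ∈ C([U(⟨a′⟩)], ℂ)` inside every `q`-integral and an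
existential integrable second slot `W₂` (LEAD (E6), «M-154u» (a): rev. j cand `A-plan/A-plan2-g34/K2_Liu_CurveThetaNonOrthogonal.revj.cand.E6B.A-plan2-g34.lean`
b6850b1f50261dfa, `SeesawFubini` :518–:571).  THIS FILE proves that rev. j stub TOKEN FOR TOKEN — `theorem seesawFubiniWeighted : ‹SeesawFubini (rev. j)›` —
so the tier-0 line re-ties `stub_seesawFubini` BY NAME and its sorry count returns to 2 ({s23, s5}).

CLAIM.  In the curve frame of the letters (★ `Liu2021.curveTheta_nonOrthogonal₂`): if for some finite invariant open-positive Borel `ν` on `[U(⟨a′⟩)]`, some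
continuous weight `f′` and some integrable `W₂` on `[G]` the doubling pairing of the WEIGHTED see-saw kernel
`K(x₁, x₂) = ∫_{[U(⟨a′⟩)]} f′(q) · (conj κ¹_q(x₁) · κ²_q(x₂)) dν(q)` against `w ∈ P` and `W₂` is non-zero, then the OPPOSITE LIFT
`Θᵗ_{Φ₁}(w̄)(q₀) = ∫_{[G]} conj(w) κ¹_{q₀} dμ` is non-zero at some `q₀` (witnesses `(Φ, w₀) := (Φ₁, w)`).
PROOF = the proof of ★ `K2LiuSeesawFubini.seesawFubini` (p855037) with the weight `star (f′ · g₂)`, `g₂(q) = θ_{Φ₂}(aQ x₂, q)`, in place of `star g₂`: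
suppose `Θᵗ_{Φ₁}(w̄) ≡ 0`; (J) for every `x₂`, `∫_{x₁} K(x₁,x₂) w(x₁) dμ = 0` — its conjugate is `⟪w, [Θ̃_{Φ₁}(star (f′·g₂)) ∘ ιA]⟫`, which the ADJUNCTION
★ `F0LD1ThetaAdjunctionOfClass.inner_toLp_lineThetaLift_eq_integral` rewrites as `∫_q Θᵗ_{Φ₁}(w̄)(q) · (star (f′·g₂))(q) dν = 0`; then the doubling pairing
vanishes for EVERY second slot `W₂` (Mathlib `integral_prod_symm` + `integral_mul_const` when integrable, junk `0` otherwise) — `W₂` is never inspected.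

HONEST LABEL: HC_CM is proved only modulo the 7 printed citations (2 remaining named inputs: hLiu418 = stmt-HodgeConjecture-24832, h413 =
stmt-HodgeConjecture-24833) until rung 0 closes; this file is a `--supports stmt-HodgeConjecture-24832 --as helper` file (it discharges the line's stub s6′
BY VALUE) and retires nothing by itself.

References: [HarrisKudlaSweet1996] §1 Lem. 1.1; [Liu2021] App. B §B.1 (p. 97), Thm. B.4 (1)(c) (p. 98), p. 104–105 (separation of variables);
[FleigEtAl2018] §12.3 Def. 12.5 (12.37)–(12.38) p. 296; [GetzHahn2024] Thm. 3.2.2 p. 57.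
-/

set_option autoImplicit false
-- statements over the theta-kernel datum elaborate to very large types; elaborate sequentially (as in ★ `K2LiuSeesawFubini`)
set_option Elab.async false
set_option linter.dupNamespace false

noncomputable section

open NumberField NumberField.InfinitePlace MeasureTheory IsDedekindDomain
open scoped Matrix ComplexOrder ENNReal InnerProductSpace ComplexConjugate
open scoped NNReal Topology
open Filter Complex Set
open Literature.NumberTheory.Automorphic Literature.NumberTheory.Automorphic.UnitaryGroup
open Literature.NumberTheory.Automorphic.UnitaryGroup.CotangentForms
open Literature.NumberTheory.Automorphic.UnitaryCurveForms
open Literature.NumberTheory.Automorphic.IdeleClassGroup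
open Literature.NumberTheory.Automorphic.Liu2021
open Literature.NumberTheory.Automorphic.Liu2021.Def411WeilCarriers
open Literature.NumberTheory.Automorphic.Liu2021.Def411WeilCarriersDoubling
open Literature.NumberTheory.GaloisRepresentations
open Literature.NumberTheory.GelbartRogawski1991 Literature.NumberTheory.GelbartRogawski1991.UnitaryDualPair
open Literature.NumberTheory.GelbartRogawski1991.GRConstruction (HA)
open Literature.NumberTheory.Weil1964
open Literature.RepresentationTheory.Liu2021 Literature.RepresentationTheory.HarrisKudlaSweet1996
open Literature.MeasureTheory.Integral

namespace Summit.HodgeConjecture.HodgeConjecture.Cruxes.HLiu418.K2LiuSeesawFubiniWeighted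

open _root_.MeasureTheory
open Summit.HodgeConjecture.HodgeConjecture.Cruxes.HLiu418.F0LD1ThetaTransportKit
open Summit.HodgeConjecture.HodgeConjecture.Cruxes.HLiu418.F0LD1ThetaAdjunctionOfClass
open Summit.HodgeConjecture.HodgeConjecture.Cruxes.HLiu418.F0LD2FrameTransportPin (continuous_of_pin mem_range_toAdelic_of_pin)
open Summit.HodgeConjecture.HodgeConjecture.Cruxes.HLiu418.F0LD1ScalarFrameTransport (hasThetaMajorants_lineThetaKernelDatum₂)

set_option maxHeartbeats 1000000 in -- the theta-kernel datum's statement telescope (≈ 60 binders) + five kernel-sized `have`s (as ★ s6)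
/-- **PAYMENT OF THE WEIGHTED SEE-SAW STUB s6′** (`SeesawFubini` of the tier-0 line rev. j, TOKEN FOR TOKEN).  If for some finite invariant open-positive
Borel `ν` on `[U(⟨a′⟩)]`, some continuous weight `f′` on `[U(⟨a′⟩)]` and some integrable `W₂` on `[G]` the doubling pairing of the weighted see-saw kernel
`x ↦ ∫_q f′(q) · (conj θ_{Φ₁}(x₁, q) · θ_{Φ₂}(x₂, q)) dν` against `w ∈ P` and `W₂` is non-zero, then for some `q₀` the opposite lift
`∫_{[G]} conj(w) · θ_{Φ₁}(·, q₀) dμ` is non-zero.  Proof: as ★ `seesawFubini` with the continuous weight `star (f′ · g₂)`, `g₂ = θ_{Φ₂}(aQ x₂, ·)`.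
[cite: HarrisKudlaSweet1996, §1 L1.1] [cite: Liu2021, App. B §B.1 (p. 97 L10–18); Thm. B.4 (1)(c) (p. 98); p. 105] [cite: FleigEtAl2018, §12.3 Def. 12.5 (12.37)–(12.38) p. 296] -/
theorem seesawFubiniWeighted :
  ∀ (L : Type) [Field L] [NumberField L] [IsCMField L] (ι : L →+* ℂ) (H : Matrix (Fin 2) (Fin 2) L)
    (dV : Fin 2 → L) (hdV : ∀ i, IsCMField.complexConj L (dV i) = dV i) (hdV0 : ∀ i, dV i ≠ 0)
    (t : L) (ht : t ≠ 0) (g : GL (Fin 2) L)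
    (hg : formCongr ((IsCMField.complexConj L : L ≃ₐ[↥(maximalRealSubfield L)] L) : L →+* L) g (t • H) = Matrix.diagonal dV),
    (∃ T : GL (Fin 2) ℂ, formCongr (starRingEnd ℂ) T ((Matrix.diagonal dV).map ι) = Matrix.diagonal ![(1 : ℂ), -1]) →
    ∀ (hpos : ∀ τ' : L →+* ℂ, InfinitePlace.mk τ' ≠ InfinitePlace.mk ι → ((Matrix.diagonal dV).map τ').PosDef),
    4 ≤ Module.finrank ℚ L →
    ∀ (μ : Measure (adelicGroupData (↥(maximalRealSubfield L)) L (IsCMField.complexConj L) 2 H).automorphicQuotient)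
      [(adelicGroupData (↥(maximalRealSubfield L)) L (IsCMField.complexConj L) 2 H).IsAutomorphicMeasure μ]
      {n' : ℕ} (e₁ : Fin 2 × Fin 1 ≃ Fin n')
      (lam : Literature.NumberTheory.Automorphic.IdeleClassGroup L →ₜ* Circle) (hlam : IsConjugateSymplectic L lam), HasWeight L lam 1 →
    ∀ (a : (↥(maximalRealSubfield L))ˣ) (χ : Chi (↥(maximalRealSubfield L)) L (IsCMField.complexConj L))
      (W : Type) [AddCommGroup W] [Module ℂ W]
      (σ : Representation ℂ (finAdelic (↥(maximalRealSubfield L)) L (IsCMField.complexConj L) 2 H) W),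
      σ.IsIrreducible → σ.IsSmooth →
    ∀ j : σ.IntertwiningMap
        ((rhoVAtLine (↥(maximalRealSubfield L)) L (IsCMField.complexConj L) 2 e₁ (Matrix.diagonal dV)
            (complexConj_imagUnit L) (imagUnit_ne_zero L) (imagUnit_mul_self L) (realDiagonal_isSymm L dV hdV)
            (isUnit_det_realDiagonal L dV hdV hdV0) (realDiagonal_map L dV hdV).symm
            (fun a => isCompatible_chiSplittingLine L e₁ dV hdV hdV0 (toHeckeCharacter L lam)
              (isUnitary_toHeckeCharacter L lam) ((isOscillatorChar_toHeckeCharacter_iff lam).mpr hlam)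
              (TW (↥(maximalRealSubfield L)) a) (isSymm_TW (↥(maximalRealSubfield L)) a)
              (isUnit_det_TW (↥(maximalRealSubfield L)) a) (JW (↥(maximalRealSubfield L)) L a)
              (JW_eq (↥(maximalRealSubfield L)) L a)) a χ).comp
          (finAdelicCongr (↥(maximalRealSubfield L)) L (IsCMField.complexConj L) g ht hg).symm.toMonoidHom),
      Function.Injective j →
    ∀ (ιA : (adelicGroupData (↥(maximalRealSubfield L)) L (IsCMField.complexConj L) 2 H).Adelic →*
        ↥(UnitaryGroup.adelic (↥(maximalRealSubfield L)) L (IsCMField.complexConj L) 2 (Matrix.diagonal dV))),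
      (∀ k, ((ιA k : ↥(UnitaryGroup.adelic (↥(maximalRealSubfield L)) L (IsCMField.complexConj L) 2 (Matrix.diagonal dV))) :
            GL (Fin 2) (AdeleRing (𝓞 L) L)) =
          (toAdeleGL L g)⁻¹ * adelicVal (↥(maximalRealSubfield L)) L (IsCMField.complexConj L) 2 H k * toAdeleGL L g) →
    ∀ [CompactSpace (↥(UnitaryGroup.adelic (↥(maximalRealSubfield L)) L (IsCMField.complexConj L) 2 (Matrix.diagonal dV)) ⧸
        (UnitaryGroup.toAdelic (↥(maximalRealSubfield L)) L (IsCMField.complexConj L) 2 (Matrix.diagonal dV)).range)]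
      [CompactSpace (adelicGroupData (↥(maximalRealSubfield L)) L (IsCMField.complexConj L) 2 H).automorphicQuotient],
    ∀ P : DiscreteAutomorphicRep (adelicGroupData (↥(maximalRealSubfield L)) L (IsCMField.complexConj L) 2 H) μ,
      P.HasFinComponent σ →
      ∀ (a' : (↥(maximalRealSubfield L))ˣ) (Φ₁ Φ₂ : piSchwartzBruhat (↥(maximalRealSubfield L)) (Fin n'))
        (w : (adelicGroupData (↥(maximalRealSubfield L)) L (IsCMField.complexConj L) 2 H).L2 μ), w ∈ P.space.toSubmodule →
      (letI : MeasurableSpace (↥(UnitaryGroup.adelic (↥(maximalRealSubfield L)) L (IsCMField.complexConj L) 1 (JW (↥(maximalRealSubfield L)) L a')) ⧸ (UnitaryGroup.toAdelic (↥(maximalRealSubfield L)) L (IsCMField.complexConj L) 1 (JW (↥(maximalRealSubfield L)) L a')).range) := borel _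
        ∃ (ν : Measure (↥(UnitaryGroup.adelic (↥(maximalRealSubfield L)) L (IsCMField.complexConj L) 1 (JW (↥(maximalRealSubfield L)) L a')) ⧸ (UnitaryGroup.toAdelic (↥(maximalRealSubfield L)) L (IsCMField.complexConj L) 1 (JW (↥(maximalRealSubfield L)) L a')).range))
          (_ : IsFiniteMeasure ν) (_ : SMulInvariantMeasure ↥(UnitaryGroup.adelic (↥(maximalRealSubfield L)) L (IsCMField.complexConj L) 1 (JW (↥(maximalRealSubfield L)) L a')) (↥(UnitaryGroup.adelic (↥(maximalRealSubfield L)) L (IsCMField.complexConj L) 1 (JW (↥(maximalRealSubfield L)) L a')) ⧸ (UnitaryGroup.toAdelic (↥(maximalRealSubfield L)) L (IsCMField.complexConj L) 1 (JW (↥(maximalRealSubfield L)) L a')).range) ν) (_ : ν.IsOpenPosMeasure) (f' : C((↥(UnitaryGroup.adelic (↥(maximalRealSubfield L)) L (IsCMField.complexConj L) 1 (JW (↥(maximalRealSubfield L)) L a')) ⧸ (UnitaryGroup.toAdelic (↥(maximalRealSubfield L)) L (IsCMField.complexConj L) 1 (JW (↥(maximalRealSubfield L)) L a')).range), ℂ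))
          (W₂ : (adelicGroupData (↥(maximalRealSubfield L)) L (IsCMField.complexConj L) 2 H).automorphicQuotient → ℂ), Integrable W₂ μ ∧
          Literature.NumberTheory.K2Lit.SiegelDoubled.doublingPairing (adelicGroupData (↥(maximalRealSubfield L)) L (IsCMField.complexConj L) 2 H) μ
            (fun x => ∫ q, f' q * (conj (toQuotFun (adelicGroupData (↥(maximalRealSubfield L)) L (IsCMField.complexConj L) 2 H)
                (fun y => (lineThetaKernelDatum L 2 e₁ dV hdV hdV0 lam hlam a'
              (hasThetaMajorants_lineThetaKernelDatum₂ L ι e₁ dV hdV hdV0 hpos lam hlam a')).thetaKer Φ₁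
                (QuotientGroup.mk (ιA y)⁻¹, q)) x.1) *
              toQuotFun (adelicGroupData (↥(maximalRealSubfield L)) L (IsCMField.complexConj L) 2 H)
                (fun y => (lineThetaKernelDatum L 2 e₁ dV hdV hdV0 lam hlam a'
              (hasThetaMajorants_lineThetaKernelDatum₂ L ι e₁ dV hdV hdV0 hpos lam hlam a')).thetaKer Φ₂
                (QuotientGroup.mk (ιA y)⁻¹, q)) x.2) ∂ν)
            (fun α => w α) W₂ ≠ 0) →
      ∃ (Φ : piSchwartzBruhat (↥(maximalRealSubfield L)) (Fin n')) (w₀ : (adelicGroupData (↥(maximalRealSubfield L)) L (IsCMField.complexConj L) 2 H).L2 μ) (_ : w₀ ∈ P.space.toSubmodule)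
        (q₀ : (↥(UnitaryGroup.adelic (↥(maximalRealSubfield L)) L (IsCMField.complexConj L) 1 (JW (↥(maximalRealSubfield L)) L a')) ⧸ (UnitaryGroup.toAdelic (↥(maximalRealSubfield L)) L (IsCMField.complexConj L) 1 (JW (↥(maximalRealSubfield L)) L a')).range)),
        ∫ α, conj (w₀ α) * toQuotFun (adelicGroupData (↥(maximalRealSubfield L)) L (IsCMField.complexConj L) 2 H)
          (fun y => (lineThetaKernelDatum L 2 e₁ dV hdV hdV0 lam hlam a'
              (hasThetaMajorants_lineThetaKernelDatum₂ L ι e₁ dV hdV hdV0 hpos lam hlam a')).thetaKer Φ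
                (QuotientGroup.mk (ιA y)⁻¹, q₀)) α ∂μ ≠ 0 := by
  intro L _ _ _ ι H dV hdV hdV0 t ht g hg hT hpos h4 μ _ n' e₁ lam hlam hwt a χ W _ _ σ hirr hsm j hj ιA hιA _ _ P hfin a' Φ₁ Φ₂
    w hw hyp
  -- Borel data, normality and compactness of `[U(⟨a′⟩)]`
  letI : MeasurableSpace (↥(UnitaryGroup.adelic (↥(maximalRealSubfield L)) L (IsCMField.complexConj L) 1 (JW (↥(maximalRealSubfield L)) L a')) ⧸
      (UnitaryGroup.toAdelic (↥(maximalRealSubfield L)) L (IsCMField.complexConj L) 1 (JW (↥(maximalRealSubfield L)) L a')).range) := borel _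
  haveI : BorelSpace (↥(UnitaryGroup.adelic (↥(maximalRealSubfield L)) L (IsCMField.complexConj L) 1 (JW (↥(maximalRealSubfield L)) L a')) ⧸
      (UnitaryGroup.toAdelic (↥(maximalRealSubfield L)) L (IsCMField.complexConj L) 1 (JW (↥(maximalRealSubfield L)) L a')).range) := ⟨rfl⟩
  haveI := normal_range_toAdelic_JW L a'
  haveI := compactSpace_quotient_range_toAdelic_JW L a'
  obtain ⟨ν, hνfin, hνinv, hνpos, f', W₂, hW₂, hne⟩ := hyp
  -- the pinned transport is continuous and carries rational points to rational points
  have hιA' : Continuous ιA ∧ ∀ ⦃γ : (adelicGroupData (↥(maximalRealSubfield L)) L (IsCMField.complexConj L) 2 H).Adelic⦄,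
      γ ∈ (UnitaryGroup.toAdelic (↥(maximalRealSubfield L)) L (IsCMField.complexConj L) 2 H).range →
        ιA γ ∈ (UnitaryGroup.toAdelic (↥(maximalRealSubfield L)) L (IsCMField.complexConj L) 2 (Matrix.diagonal dV)).range :=
    ⟨continuous_of_pin L 2 H dV g ιA hιA, fun _ hγ => mem_range_toAdelic_of_pin L 2 H dV t ht g hg ιA hιA hγ⟩
  refine ⟨Φ₁, w, hw, ?_⟩
  by_contra hall
  push Not at hall
  refine hne ?_
  -- the kernel slices on `[U(H)]`, read through a transport `aQ` on the quotients
  obtain ⟨aQ, haQ⟩ := exists_quotientTransport L 2 H dV ιA hιA'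
  have hκ₂ : ∀ q α, toQuotFun (adelicGroupData (↥(maximalRealSubfield L)) L (IsCMField.complexConj L) 2 H)
      (fun y => (lineThetaKernelDatum L 2 e₁ dV hdV hdV0 lam hlam a'
        (hasThetaMajorants_lineThetaKernelDatum₂ L ι e₁ dV hdV hdV0 hpos lam hlam a')).thetaKer Φ₂ (QuotientGroup.mk (ιA y)⁻¹, q)) α =
      (lineThetaKernelDatum L 2 e₁ dV hdV hdV0 lam hlam a'
        (hasThetaMajorants_lineThetaKernelDatum₂ L ι e₁ dV hdV hdV0 hpos lam hlam a')).thetaKer Φ₂ (aQ α, q) := fun q α =>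
    toQuotFun_thetaKer_eq_of_quotientTransport L 2 H e₁ dV hdV hdV0 ιA hιA' lam hlam a' _ Φ₂ aQ haQ q α
  -- (J) for every `x₂`: `∫ K(x₁,x₂) w(x₁) dμ(x₁) = 0` — by the adjunction ★ (T1) with the continuous weight `q ↦ conj θ_{Φ₂}(aQ x₂, q)`
  have hJ : ∀ x₂ : (adelicGroupData (↥(maximalRealSubfield L)) L (IsCMField.complexConj L) 2 H).automorphicQuotient,
      ∫ x₁, (∫ q, f' q * (conj (toQuotFun (adelicGroupData (↥(maximalRealSubfield L)) L (IsCMField.complexConj L) 2 H)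
          (fun y => (lineThetaKernelDatum L 2 e₁ dV hdV hdV0 lam hlam a'
            (hasThetaMajorants_lineThetaKernelDatum₂ L ι e₁ dV hdV hdV0 hpos lam hlam a')).thetaKer Φ₁ (QuotientGroup.mk (ιA y)⁻¹, q)) x₁) *
        toQuotFun (adelicGroupData (↥(maximalRealSubfield L)) L (IsCMField.complexConj L) 2 H)
          (fun y => (lineThetaKernelDatum L 2 e₁ dV hdV hdV0 lam hlam a'
            (hasThetaMajorants_lineThetaKernelDatum₂ L ι e₁ dV hdV hdV0 hpos lam hlam a')).thetaKer Φ₂ (QuotientGroup.mk (ιA y)⁻¹, q)) x₂) ∂ν) *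
        w x₁ ∂μ = 0 := by
    intro x₂
    -- the continuous weight `f₂(q) = conj θ_{Φ₂}(aQ x₂, q)`
    set g₂ : C((↥(UnitaryGroup.adelic (↥(maximalRealSubfield L)) L (IsCMField.complexConj L) 1 (JW (↥(maximalRealSubfield L)) L a')) ⧸
        (UnitaryGroup.toAdelic (↥(maximalRealSubfield L)) L (IsCMField.complexConj L) 1 (JW (↥(maximalRealSubfield L)) L a')).range), ℂ) :=
      ((lineThetaKernelDatum L 2 e₁ dV hdV hdV0 lam hlam a'
        (hasThetaMajorants_lineThetaKernelDatum₂ L ι e₁ dV hdV hdV0 hpos lam hlam a')).thetaKer Φ₂).comp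
        ((ContinuousMap.const _ (aQ x₂)).prodMk (ContinuousMap.id _)) with hg₂
    have hg₂ap : ∀ q, g₂ q = (lineThetaKernelDatum L 2 e₁ dV hdV hdV0 lam hlam a'
        (hasThetaMajorants_lineThetaKernelDatum₂ L ι e₁ dV hdV hdV0 hpos lam hlam a')).thetaKer Φ₂ (aQ x₂, q) := fun q => rfl
    have hf₂ap : ∀ q, (star (f' * g₂)) q = conj (f' q) * conj (toQuotFun (adelicGroupData (↥(maximalRealSubfield L)) L (IsCMField.complexConj L) 2 H)
          (fun y => (lineThetaKernelDatum L 2 e₁ dV hdV hdV0 lam hlam a'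
            (hasThetaMajorants_lineThetaKernelDatum₂ L ι e₁ dV hdV hdV0 hpos lam hlam a')).thetaKer Φ₂ (QuotientGroup.mk (ιA y)⁻¹, q)) x₂) := fun q => by
      rw [ContinuousMap.star_apply, ContinuousMap.mul_apply, star_mul', Complex.star_def, hg₂ap, hκ₂]
    -- ★ (T1): `⟪w, [Θ̃_{Φ₁}(star g₂) ∘ ιA]⟫ = ∫_q Θᵗ_{Φ₁}(w̄)(q) · (star g₂)(q) dν = 0`
    have hT1 := inner_toLp_lineThetaLift_eq_integral L 2 H e₁ dV hdV hdV0 ιA hιA' lam hlam a'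
      (hasThetaMajorants_lineThetaKernelDatum₂ L ι e₁ dV hdV hdV0 hpos lam hlam a') ν Φ₁ (star (f' * g₂)) w
    have hR : ∫ q, (∫ α, conj (w α) * toQuotFun (adelicGroupData (↥(maximalRealSubfield L)) L (IsCMField.complexConj L) 2 H)
          (fun y => (lineThetaKernelDatum L 2 e₁ dV hdV hdV0 lam hlam a'
            (hasThetaMajorants_lineThetaKernelDatum₂ L ι e₁ dV hdV hdV0 hpos lam hlam a')).thetaKer Φ₁ (QuotientGroup.mk (ιA y)⁻¹, q)) α ∂μ) *
          (star (f' * g₂)) q ∂ν = 0 := by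
      simp only [hall, zero_mul, integral_zero]
    -- the left side of (T1) as an honest integral against `w`
    have hL : ⟪w, MemLp.toLp _ (memLp_toQuotFun_lineThetaLift L 2 H e₁ dV hdV hdV0 ιA hιA' lam hlam a'
        (hasThetaMajorants_lineThetaKernelDatum₂ L ι e₁ dV hdV hdV0 hpos lam hlam a') ν Φ₁ (star (f' * g₂)) μ 2)⟫_ℂ =
        ∫ α, conj (w α) * (∫ q, toQuotFun (adelicGroupData (↥(maximalRealSubfield L)) L (IsCMField.complexConj L) 2 H)
          (fun y => (lineThetaKernelDatum L 2 e₁ dV hdV hdV0 lam hlam a'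
            (hasThetaMajorants_lineThetaKernelDatum₂ L ι e₁ dV hdV hdV0 hpos lam hlam a')).thetaKer Φ₁ (QuotientGroup.mk (ιA y)⁻¹, q)) α *
          (star (f' * g₂)) q ∂ν) ∂μ := by
      rw [MeasureTheory.L2.inner_def]
      refine integral_congr_ae ?_
      filter_upwards [MemLp.coeFn_toLp (memLp_toQuotFun_lineThetaLift L 2 H e₁ dV hdV hdV0 ιA hιA' lam hlam a'
        (hasThetaMajorants_lineThetaKernelDatum₂ L ι e₁ dV hdV hdV0 hpos lam hlam a') ν Φ₁ (star (f' * g₂)) μ 2)] with α hα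
      rw [hα, RCLike.inner_apply, mul_comm,
        toQuotFun_lineThetaLift_eq_integral_toQuotFun_thetaKer L 2 H e₁ dV hdV hdV0 ιA hιA' lam hlam a'
          (hasThetaMajorants_lineThetaKernelDatum₂ L ι e₁ dV hdV hdV0 hpos lam hlam a') Φ₁ ν (star (f' * g₂)) α]
    have hstar : ∫ α, conj (w α) * (∫ q, toQuotFun (adelicGroupData (↥(maximalRealSubfield L)) L (IsCMField.complexConj L) 2 H)
          (fun y => (lineThetaKernelDatum L 2 e₁ dV hdV hdV0 lam hlam a'
            (hasThetaMajorants_lineThetaKernelDatum₂ L ι e₁ dV hdV hdV0 hpos lam hlam a')).thetaKer Φ₁ (QuotientGroup.mk (ιA y)⁻¹, q)) α *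
          (star (f' * g₂)) q ∂ν) ∂μ = 0 := by
      rw [← hL, hT1, hR]
    -- conjugate: `conj J(x₂)` is that integral
    have hconj : conj (∫ x₁, (∫ q, f' q * (conj (toQuotFun (adelicGroupData (↥(maximalRealSubfield L)) L (IsCMField.complexConj L) 2 H)
          (fun y => (lineThetaKernelDatum L 2 e₁ dV hdV hdV0 lam hlam a'
            (hasThetaMajorants_lineThetaKernelDatum₂ L ι e₁ dV hdV hdV0 hpos lam hlam a')).thetaKer Φ₁ (QuotientGroup.mk (ιA y)⁻¹, q)) x₁) *
        toQuotFun (adelicGroupData (↥(maximalRealSubfield L)) L (IsCMField.complexConj L) 2 H)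
          (fun y => (lineThetaKernelDatum L 2 e₁ dV hdV hdV0 lam hlam a'
            (hasThetaMajorants_lineThetaKernelDatum₂ L ι e₁ dV hdV hdV0 hpos lam hlam a')).thetaKer Φ₂ (QuotientGroup.mk (ιA y)⁻¹, q)) x₂) ∂ν) *
        w x₁ ∂μ) = 0 := by
      rw [← integral_conj]
      refine Eq.trans (integral_congr_ae (Filter.Eventually.of_forall fun x₁ => ?_)) hstar
      dsimp only
      rw [map_mul, mul_comm]
      congr 1
      rw [← integral_conj]
      refine integral_congr_ae (Filter.Eventually.of_forall fun q => ?_)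
      dsimp only
      rw [map_mul, map_mul, Complex.conj_conj, hf₂ap]
      ring
    have h := congrArg conj hconj
    rwa [Complex.conj_conj, map_zero] at h
  -- the doubling pairing vanishes for EVERY second slot (`W₂` is never inspected): Fubini on `[G] × [G]` when the integrand is integrable
  -- (junk `0` otherwise), inner integral `= J(x₂) · conj W₂(x₂) = 0`
  unfold Literature.NumberTheory.K2Lit.SiegelDoubled.doublingPairing
  by_cases hint : Integrable (fun x : (adelicGroupData (↥(maximalRealSubfield L)) L (IsCMField.complexConj L) 2 H).automorphicQuotient ×
        (adelicGroupData (↥(maximalRealSubfield L)) L (IsCMField.complexConj L) 2 H).automorphicQuotient =>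
      (∫ q, f' q * (conj (toQuotFun (adelicGroupData (↥(maximalRealSubfield L)) L (IsCMField.complexConj L) 2 H)
          (fun y => (lineThetaKernelDatum L 2 e₁ dV hdV hdV0 lam hlam a'
            (hasThetaMajorants_lineThetaKernelDatum₂ L ι e₁ dV hdV hdV0 hpos lam hlam a')).thetaKer Φ₁ (QuotientGroup.mk (ιA y)⁻¹, q)) x.1) *
        toQuotFun (adelicGroupData (↥(maximalRealSubfield L)) L (IsCMField.complexConj L) 2 H)
          (fun y => (lineThetaKernelDatum L 2 e₁ dV hdV hdV0 lam hlam a'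
            (hasThetaMajorants_lineThetaKernelDatum₂ L ι e₁ dV hdV hdV0 hpos lam hlam a')).thetaKer Φ₂ (QuotientGroup.mk (ιA y)⁻¹, q)) x.2) ∂ν) *
        w x.1 * conj (W₂ x.2)) (μ.prod μ)
  · rw [integral_prod_symm _ hint]
    have hinner : ∀ x₂ : (adelicGroupData (↥(maximalRealSubfield L)) L (IsCMField.complexConj L) 2 H).automorphicQuotient,
        ∫ x₁, (∫ q, f' q * (conj (toQuotFun (adelicGroupData (↥(maximalRealSubfield L)) L (IsCMField.complexConj L) 2 H)
            (fun y => (lineThetaKernelDatum L 2 e₁ dV hdV hdV0 lam hlam a'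
              (hasThetaMajorants_lineThetaKernelDatum₂ L ι e₁ dV hdV hdV0 hpos lam hlam a')).thetaKer Φ₁ (QuotientGroup.mk (ιA y)⁻¹, q)) x₁) *
          toQuotFun (adelicGroupData (↥(maximalRealSubfield L)) L (IsCMField.complexConj L) 2 H)
            (fun y => (lineThetaKernelDatum L 2 e₁ dV hdV hdV0 lam hlam a'
              (hasThetaMajorants_lineThetaKernelDatum₂ L ι e₁ dV hdV hdV0 hpos lam hlam a')).thetaKer Φ₂ (QuotientGroup.mk (ιA y)⁻¹, q)) x₂) ∂ν) *
          w x₁ * conj (W₂ x₂) ∂μ = 0 := fun x₂ => by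
      rw [integral_mul_const, hJ x₂, zero_mul]
    simp only [hinner, integral_zero]
  · exact integral_undef hint


end Summit.HodgeConjecture.HodgeConjecture.Cruxes.HLiu418.K2LiuSeesawFubiniWeighted

end
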